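import Literature.Probability.LatticeModels.ModifiedSimonInequality
import Literature.Probability.LatticeModels.GKSInequalities
import Mathlib.Analysis.SpecialFunctions.Trigonometric.DerivHyp
import Mathlib.Analysis.SpecialFunctions.Artanh
import HarnessLib

/-!
# Domain monotonicity of the high-temperature generating sums

Griffiths' second inequality (monotonicity of the free-boundary Ising correlations in the
volume, `isingCorr_free_le_of_subset`) in high-temperature-expansion dress: with
`g_Λ(A) = hteSum G Λ t A = ∑_{R ⊆ ℰ_Λ, ∂R = A} t^{|R|}`, for `0 ≤ t < 1` and `A ⊆ Λ`,

  `g_Λ(A) · g_V(∅) ≤ g_V(A) · g_Λ(∅)`,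

i.e. `⟨σ_A⟩^free_Λ ≤ ⟨σ_A⟩^free_V` at `t = tanh β` (`β = artanh t ≥ 0`), after the
high-temperature expansion `⟨σ_A⟩^free_Λ = g_Λ(A)/g_Λ(∅)` (`isingCorr_free_eq_hteSum_div`) and
clearing the positive denominators `g(∅) > 0` (`hteSum_empty_pos`).
-/

noncomputable section

open Finset SimpleGraph
open Literature.Probability.LatticeModels

namespace Summit.CriticalPhenomena.Ising3DConformalLimit.Theorems.StrandShadowFootprint

open scoped Classical

/-- **Domain monotonicity of the high-temperature sums** (Griffiths' second inequality in
high-temperature dress).  For `0 ≤ t < 1` and `A ⊆ Λ`: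
`g_Λ(A) · g_V(∅) ≤ g_V(A) · g_Λ(∅)` with `g_Λ = hteSum G Λ t`, i.e.
`⟨σ_A⟩^free_Λ ≤ ⟨σ_A⟩^free_V` at `t = tanh β`: invert `tanh` on `[0, 1)` by `β = artanh t ≥ 0`,
apply `isingCorr_free_le_of_subset` with `Λ ⊆ univ`, rewrite both sides with
`isingCorr_free_eq_hteSum_div`, and clear the positive denominators `hteSum_empty_pos`. -/
theorem stub_hteDomainMono :
    ∀ (V : Type) [Fintype V] [DecidableEq V] (G : SimpleGraph V) [DecidableRel G.Adj] (t : ℝ),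
      0 ≤ t → t < 1 → ∀ (Λ A : Finset V), A ⊆ Λ →
      hteSum G Λ t A * hteSum G Finset.univ t ∅ ≤ hteSum G Finset.univ t A * hteSum G Λ t ∅ := by
  intro V _ _ G _ t ht0 ht1 Λ A hA
  -- invert `tanh` on `[0, 1)`: `t = tanh β` with `β = artanh t ≥ 0`
  obtain ⟨β, hβ0, rfl⟩ : ∃ β : ℝ, 0 ≤ β ∧ Real.tanh β = t :=
    ⟨Real.artanh t, Real.artanh_nonneg ht0, Real.tanh_artanh ⟨by linarith, ht1⟩⟩
  -- Griffiths' second inequality `⟨σ_A⟩^free_Λ ≤ ⟨σ_A⟩^free_univ` at zero field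
  have hmono := isingCorr_free_le_of_subset G hβ0 le_rfl hA (Finset.subset_univ Λ)
  rw [isingCorr_free_eq_hteSum_div G Λ β hA,
    isingCorr_free_eq_hteSum_div G Finset.univ β (Finset.subset_univ A),
    div_le_div_iff₀ (hteSum_empty_pos G Λ β) (hteSum_empty_pos G Finset.univ β)] at hmono
  exact hmono

end Summit.CriticalPhenomena.Ising3DConformalLimit.Theorems.StrandShadowFootprint
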